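import Literature.NumberTheory.LFunctions.KhaleLemma65
import HarnessLib

/-!
# Khale 2024, Corollary 6.6 (primitive characters): the smoothed zero detector for `L(s, χ)`

Topic `Literature/NumberTheory/LFunctions`.  Everything in this file is PROVED (one definition with
a body — the near-zero sum `khaleNearSum` — and theorems; no named fact).

T. Khale, *An explicit Vinogradov–Korobov zero-free region for Dirichlet L-functions*, Q. J. Math.
75 (2024) = arXiv:2210.06457v1, **Corollary 6.6** (pp. 16–17): assume (2.4) with constants `A, B`
(`HasHurwitzFordBound A B`); let `χ` (mod `q`), `q ≥ 3`, `1.92(log(t/100))^{−2/3} < η < 1/2`, `f`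
compactly supported satisfying (6.5) with constant `D`, `s = 1 + it`,
`t ≥ max{q^{1/100000}, e^{1938}}`.  Then
`Re K_χ(s) ≤ −Σ_{|1+it−ρ|≤η} Re{F(s−ρ) + f(0)((π/2η)cot(π(s−ρ)/2η) − 1/(s−ρ))}`
`  + (f(0)/2η)[⅔ log log t + Bη^{3/2} log t + log(A+1) − ½∫ log|L(s + η + 2ηui/π, χ)|/cosh²u du]`
`  + D(3.5 + ⅓ log q + ⅓ log t + Σ_{|1+it−ρ|>η} |1+it−ρ|^{−2}) + I(χ)(…)Q(q) + (f(0)/2) log q`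
`  + f(0)(1 − δ(χ))(1 − a)e^{−1937}`.

This file proves the **primitive case** (`I(χ) = δ(χ) = 0`; the last printed term, which comes from
Lemma 6.2, is not needed: the tree's `KhaleL62.lemma62` is the printed Lemma 6.2 without it), for an
admissible smoothing `IsFordSmoothing f η' D` (any threshold `η' ≤ η` in (6.5)), exactly as printed
otherwise ("By combining Lemma 6.2 (with `S = {z : Re z ≤ 1, |1 + it − z| ≤ η}`) and Lemma 6.5 … we
may take `σ → 1+`"):

* `KhaleL66.re_khaleK_one_le` — Lemma 6.5 (`KhaleL65.re_khaleK_le'`) **at `s = 1 + it`**, by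
  `σ → 1+` (`K_χ`, `L'/L`, `F₀(s − ρ)` are continuous at `1 + it`);
* `KhaleL66.corollary66` — **Corollary 6.6, primitive `χ` modulo `q ≥ 3`**:
  `Re K_χ(1+it) ≤ −khaleNearSum χ f η t`
  `  + (f(0)/2η)[⅔ log log t + Bη^{3/2} log t + log(A+1)] + (f(0)/2) log q`
  `  − (f(0)/4η) ∫ log|L(1 + η + i(t + 2ηu/π), χ)|/cosh²u du`
  `  + D(3.11 + ⅓ log q + (1/6) log(1 + t²) + 1/(1 + t²) + S)`,
  where `S` bounds the strict far-zero sum (`KhaleFarZeroSumLT χ t η S`) and the error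
  `3.11 + (1/6) log(1+t²) + 1/(1+t²) ≤ 3.5 + ⅓ log t` is below the printed one
  (`KhaleL66.corollary66'`).

## References

* T. Khale, arXiv:2210.06457v1, Corollary 6.6 and its proof (pp. 16–17); Lemma 6.2; Lemma 6.5.
  [Khale2024]
* K. Ford, *Zero-free regions for the Riemann zeta function* (2002), Lemma 4.6 and (4.10).
  [Ford2002Millennium]
-/

noncomputable section

open Complex Real MeasureTheory Set Filter Topology
open Literature.Analysis.Complex Literature.Analysis.Complex.FordDetector

namespace Literature.NumberTheory.LFunctions

variable {q : ℕ} [NeZero q]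

/-- **The near-zero sum of Corollary 6.6** at height `t`:
`Σ_{|1+it−ρ| ≤ η} m(ρ) Re{F(1 + it − ρ) + f(0)((π/2η) cot((π/2η)(1 + it − ρ)) − 1/(1 + it − ρ))}`
over the zeros of `L(·, χ)` in the disc (`KhaleL63.nearZeros`, multiplicity `DirichletDisc.zeroOrder`);
the character twin of `fordNearSum`. [cite: Khale2024, Corollary 6.6] -/
def khaleNearSum (χ : DirichletCharacter ℂ q) (f : ℝ → ℝ) (η t : ℝ) : ℝ :=
  ∑ ρ ∈ KhaleL63.nearZeros χ t η, (DirichletDisc.zeroOrder χ ρ : ℝ) *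
    (fordLaplace f (1 + t * I - ρ)
      + (f 0 : ℂ) * (((π / (2 * η) : ℝ) : ℂ) * Complex.cot (((π / (2 * η) : ℝ) : ℂ) * (1 + t * I - ρ))
          - 1 / (1 + t * I - ρ))).re

namespace KhaleL66

open KhaleL65 DirichletDisc

variable {χ : DirichletCharacter ℂ q}

/-! ### Small lemmas -/

/-- `h_η(ρ − s) = −(π/2η) cot((π/2η)(s − ρ))` (the kernel is odd, `FordDetector.fordCot_neg`).
[folklore] -/
theorem fordCot_sub_rev (η : ℝ) (ρ s : ℂ) :
    fordCot η (ρ - s) = -(((π / (2 * η) : ℝ) : ℂ) * Complex.cot (((π / (2 * η) : ℝ) : ℂ) * (s - ρ))) := by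
  rw [show ρ - s = -(s - ρ) by ring, fordCot_neg, fordCot]

omit [NeZero q] in
/-- **`K_χ` is continuous** (a finite Dirichlet polynomial when `f` vanishes on `[x₀, ∞)`).
[folklore] -/
theorem continuous_khaleK (χ : DirichletCharacter ℂ q) {f : ℝ → ℝ} {x₀ : ℝ}
    (hf : ∀ u, x₀ ≤ u → f u = 0) : Continuous (khaleK χ f) := by
  set N : ℕ := ⌈Real.exp x₀⌉₊ with hN
  have hN1 : 1 ≤ N := Nat.one_le_iff_ne_zero.2 (Nat.ceil_pos.2 (Real.exp_pos _)).ne'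
  have hx : x₀ ≤ Real.log (N : ℕ) := by
    have h1 : Real.exp x₀ ≤ (N : ℕ) := Nat.le_ceil _
    have := Real.log_le_log (Real.exp_pos x₀) h1
    rwa [Real.log_exp] at this
  have heq : khaleK χ f = fun s ↦ ∑ n ∈ Finset.range N,
      ((ArithmeticFunction.vonMangoldt n : ℝ) : ℂ) * χ (n : ZMod q) * (f (Real.log n) : ℂ) *
        (n : ℂ) ^ (-s) := by
    funext s
    unfold khaleK
    refine tsum_eq_sum fun n hn ↦ ?_
    rw [Finset.mem_range, not_lt] at hn
    have hlog : x₀ ≤ Real.log n :=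
      hx.trans (Real.log_le_log (by exact_mod_cast hN1) (by exact_mod_cast hn))
    simp [hf _ hlog]
  rw [heq]
  refine continuous_finsetSum _ fun n _ ↦ ?_
  rcases Nat.eq_zero_or_pos n with rfl | hn
  · simp only [ArithmeticFunction.map_zero, Complex.ofReal_zero, zero_mul]
    exact continuous_const
  · exact continuous_const.mul (continuous_id.neg.const_cpow (Or.inl (by exact_mod_cast hn.ne')))

/-! ### Lemma 6.5 at `s = 1 + it` -/

/-- **Lemma 6.5 (primitive case) at `s = 1 + it`** ("we may take `σ → 1+`"): for `χ` primitive
modulo `q ≥ 3`, an admissible smoothing (`IsFordSmoothing f η D`, `0 < η ≤ 1/2`), real `t` and a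
bound `S` of the strict far-zero sum at height `t`,
`Re K_χ(1+it) ≤ −f(0) Re L'/L(1+it, χ) − Σ_{|1+it−ρ|≤η} m(ρ) Re F₀(1+it−ρ) + D·S + D/(1+t²)`
`  + D(3.11 + ⅓ log q + (1/6) log(1 + t²))`.
[cite: Khale2024, Lemma 6.5 and Corollary 6.6 (proof)] -/
theorem re_khaleK_one_le (hprim : χ.IsPrimitive) (hq : 3 ≤ q) {f : ℝ → ℝ} {η D : ℝ}
    (hf : IsFordSmoothing f η D) (hη : 0 < η) (hη2 : η ≤ 1 / 2) (t : ℝ) {S : ℝ}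
    (hS : KhaleFarZeroSumLT χ t η S) :
    (khaleK χ f (1 + t * I)).re ≤
      -(f 0) * (deriv χ.LFunction (1 + t * I) / χ.LFunction (1 + t * I)).re
      - (∑ ρ ∈ KhaleL63.nearZeros χ t η, (zeroOrder χ ρ : ℝ) * (fordLaplace₀ f (1 + t * I - ρ)).re)
      + D * S + D / (1 + t ^ 2)
      + D * (3.11 + Real.log q / 3 + 1 / 6 * Real.log (1 + t ^ 2)) := by
  have hχ := ne_one hprim hq
  have hLd : Differentiable ℂ χ.LFunction := DirichletCharacter.differentiable_LFunction hχ
  obtain ⟨x₀, M, hx₀, hf0, -⟩ := hf.exists_support_bound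
  have hfc := hf.contDiff.continuous
  -- the path `σ ↦ σ + it` and the two sides as functions of `σ`
  set path : ℝ → ℂ := fun σ ↦ (σ : ℂ) + t * I with hpath
  have hpath_cont : Continuous path := by rw [hpath]; fun_prop
  have hpath_im : ∀ σ, (path σ).im = t := fun σ ↦ by simp [hpath]
  have hpath_re : ∀ σ, (path σ).re = σ := fun σ ↦ by simp [hpath]
  have hpath1 : path 1 = 1 + t * I := by simp [hpath]
  set lhs : ℝ → ℝ := fun σ ↦ (khaleK χ f (path σ)).re with hlhs
  set rhs : ℝ → ℝ := fun σ ↦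
      -(f 0) * (deriv χ.LFunction (path σ) / χ.LFunction (path σ)).re
      - (∑ ρ ∈ KhaleL63.nearZeros χ t η, (zeroOrder χ ρ : ℝ) * (fordLaplace₀ f (path σ - ρ)).re)
      + D * S + D / ‖path σ‖ ^ 2
      + D * (3.11 + Real.log q / 3 + 1 / 6 * Real.log (1 + t ^ 2)) with hrhs
  -- the inequality for `σ ∈ (1, 2)`
  have hineq : ∀ᶠ σ in 𝓝[>] (1 : ℝ), lhs σ ≤ rhs σ := by
    filter_upwards [Ioo_mem_nhdsGT (show (1 : ℝ) < 2 by norm_num)] with σ hσ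
    have h := re_khaleK_le' hprim hq hf hη hη2 (s := path σ) (by rw [hpath_re]; exact hσ.1)
      (by rw [hpath_re]; exact hσ.2.le) (S := S) (by rw [hpath_im]; exact hS)
    simp only [hlhs, hrhs, hpath_im] at h ⊢
    exact h
  -- continuity of both sides at `σ = 1`
  have hL1 : χ.LFunction (path 1) ≠ 0 := by
    rw [hpath1]
    exact DirichletCharacter.LFunction_ne_zero_of_one_le_re χ (Or.inl hχ) (by simp)
  have hlhs_cont : ContinuousAt lhs 1 :=
    (Complex.continuous_re.continuousAt.comp
      ((continuous_khaleK χ hf0).continuousAt.comp hpath_cont.continuousAt))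
  have hrhs_cont : ContinuousAt rhs 1 := by
    have h1 : ContinuousAt (fun σ ↦ (deriv χ.LFunction (path σ) / χ.LFunction (path σ)).re) 1 := by
      have han := hLd.analyticAt (path 1)
      have hq' : ContinuousAt (fun w ↦ deriv χ.LFunction w / χ.LFunction w) (path 1) :=
        han.deriv.continuousAt.div han.continuousAt hL1
      exact Complex.continuous_re.continuousAt.comp (hq'.comp hpath_cont.continuousAt)
    have h2 : ∀ ρ ∈ KhaleL63.nearZeros χ t η,
        ContinuousAt (fun σ ↦ (zeroOrder χ ρ : ℝ) * (fordLaplace₀ f (path σ - ρ)).re) 1 := by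
      intro ρ hρ
      obtain ⟨h0, -⟩ := (KhaleL63.mem_nearZeros hχ).1 hρ
      have hre1 : ρ.re < 1 := DirichletDetector.re_lt_one_of_LFunction_eq_zero hχ h0
      have hne : path 1 - ρ ≠ 0 := by
        intro h
        have := congrArg Complex.re h
        rw [sub_re, hpath_re] at this
        simp at this
        linarith
      have hd := (differentiableAt_fordLaplace₀ hfc hx₀ hf0 hne).continuousAt
      refine continuousAt_const.mul (Complex.continuous_re.continuousAt.comp ?_)
      exact ContinuousAt.comp (f := fun σ : ℝ ↦ path σ - ρ) hd
        (hpath_cont.continuousAt.sub continuousAt_const)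
    have h3 : ContinuousAt (fun σ ↦ D / ‖path σ‖ ^ 2) 1 := by
      have hne : ‖path 1‖ ^ 2 ≠ 0 := by
        rw [hpath1]
        have : (1 + t * I : ℂ) ≠ 0 := by
          intro h; have := congrArg Complex.re h; simp at this
        positivity
      exact continuousAt_const.div ((continuous_norm.comp hpath_cont).continuousAt.pow 2) hne
    have hsum : ContinuousAt (fun σ ↦ ∑ ρ ∈ KhaleL63.nearZeros χ t η,
        (zeroOrder χ ρ : ℝ) * (fordLaplace₀ f (path σ - ρ)).re) 1 :=
      tendsto_finsetSum _ fun ρ hρ ↦ h2 ρ hρ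
    simp only [hrhs]
    apply ContinuousAt.add
    · apply ContinuousAt.add
      · apply ContinuousAt.add
        · apply ContinuousAt.sub
          · exact continuousAt_const.mul h1
          · exact hsum
        · exact continuousAt_const
      · exact h3
    · exact continuousAt_const
  -- pass to the limit `σ → 1+`
  have hlim : lhs 1 ≤ rhs 1 :=
    le_of_tendsto_of_tendsto (hlhs_cont.tendsto.mono_left nhdsWithin_le_nhds)
      (hrhs_cont.tendsto.mono_left nhdsWithin_le_nhds) hineq
  have hnorm : ‖(1 : ℂ) + t * I‖ ^ 2 = 1 + t ^ 2 := by
    rw [Complex.sq_norm, Complex.normSq_apply]; simp; ring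
  simp only [hlhs, hrhs, hpath1] at hlim
  rw [hnorm] at hlim
  exact hlim

/-! ### Corollary 6.6, primitive case -/

/-- The near zeros lie in the closed half-plane `Re ρ ≥ 1 − η` (indeed `|1 − Re ρ| ≤ |1 + it − ρ| ≤ η`).
[folklore] -/
theorem nearZeros_re_ge (hχ : χ ≠ 1) {t η : ℝ} {ρ : ℂ} (hρ : ρ ∈ KhaleL63.nearZeros χ t η) :
    χ.LFunction ρ = 0 ∧ 1 - η ≤ ρ.re := by
  obtain ⟨h0, hz⟩ := (KhaleL63.mem_nearZeros hχ).1 hρ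
  have h1 := Complex.abs_re_le_norm (1 + t * I - ρ)
  have hre_eq : (1 + t * I - ρ).re = 1 - ρ.re := by simp
  rw [hre_eq] at h1
  exact ⟨h0, by linarith [(abs_le.1 (h1.trans hz)).2]⟩

set_option maxHeartbeats 400000 in
/-- **Khale 2024, Corollary 6.6 — primitive characters.**  Assume (2.4) with constants `A, B > 0`
(`HasHurwitzFordBound A B`).  Let `χ` be a primitive character modulo `q ≥ 3`,
`t ≥ max(q^{1/100000}, e^{1938})`, `1.92 (log(t/100))^{−2/3} ≤ η < 1/2`, `f` an admissible smoothing
with `|F₀(z)| ≤ D/|z|²` for `Re z ≥ 0`, `|z| ≥ η'` (`IsFordSmoothing f η' D`, `0 < η' ≤ η`), and `S`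
a bound of the strict far-zero sum `Σ_{|1+it−ρ|>η} m(ρ)/|1+it−ρ|²` (`KhaleFarZeroSumLT χ t η S`).
Then
`Re K_χ(1+it) ≤ −Σ_{|1+it−ρ|≤η} m(ρ) Re{F(1+it−ρ) + f(0)((π/2η)cot((π/2η)(1+it−ρ)) − 1/(1+it−ρ))}`
`  + (f(0)/2η)[⅔ log log t + Bη^{3/2} log t + log(A+1)] + (f(0)/2) log q`
`  − (f(0)/4η) ∫ log|L(1 + η + i(t + 2ηu/π), χ)|/cosh²u du`
`  + D(3.11 + ⅓ log q + (1/6) log(1 + t²) + 1/(1 + t²) + S)`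
— Lemma 6.5 at `1 + it` (`re_khaleK_one_le`) plus `f(0)` times Lemma 6.2 at `σ = 1` with `S` the
near zeros (`KhaleL62.lemma62`), and `F₀(z) + f(0)/z = F(z)`, `h_η(ρ − s) = −(π/2η)cot((π/2η)(s − ρ))`.
[cite: Khale2024, Corollary 6.6] -/
theorem corollary66 {A B : ℝ} (hA : 0 < A) (hB : 0 < B) (hF : HasHurwitzFordBound A B)
    (hprim : χ.IsPrimitive) (hq : 3 ≤ q) {f : ℝ → ℝ} {η η' D : ℝ}
    (hf : IsFordSmoothing f η' D) (hη' : 0 < η') (hη'η : η' ≤ η) (hη2 : η < 1 / 2)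
    (hf0 : 0 ≤ f 0) {t : ℝ} (ht : Real.exp 1938 ≤ t) (htq : (q : ℝ) ^ (1 / 100000 : ℝ) ≤ t)
    (hηt : 1.92 * Real.log (t / 100) ^ (-(2 / 3 : ℝ)) ≤ η) {S : ℝ} (hS : KhaleFarZeroSumLT χ t η S) :
    (khaleK χ f (1 + t * I)).re ≤
      -khaleNearSum χ f η t
      + f 0 / (2 * η) * (2 / 3 * Real.log (Real.log t) + B * η ^ (3 / 2 : ℝ) * Real.log t
          + Real.log (A + 1))
      + f 0 / 2 * Real.log q
      - f 0 / (4 * η) * (∫ u : ℝ, Real.log ‖χ.LFunction (((1 + η : ℝ) : ℂ) +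
          ((t + u * (2 * η / π) : ℝ) : ℂ) * I)‖ / Real.cosh u ^ 2)
      + D * (3.11 + Real.log q / 3 + 1 / 6 * Real.log (1 + t ^ 2) + 1 / (1 + t ^ 2) + S) := by
  classical
  have hχ := ne_one hprim hq
  have hη : 0 < η := hη'.trans_le hη'η
  -- the smoothing is admissible from the threshold `η` on as well
  have hfη : IsFordSmoothing f η D :=
    ⟨hf.contDiff, hf.nonneg, hf.eventually_zero, fun z hz hzη ↦ hf.laplace_bound z hz (hη'η.trans hzη)⟩
  set s : ℂ := 1 + t * I with hs
  -- Lemma 6.5 at `1 + it`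
  have h65 := re_khaleK_one_le hprim hq hfη hη (by linarith) t hS
  -- Lemma 6.2 at `σ = 1` with `S` = the near zeros
  have h62 := KhaleL62.lemma62 hA hB hF hq hχ (σ := 1) (t := t) (η := η) ht htq hη (by linarith)
    (by linarith) le_rfl (by linarith) (by linarith) (KhaleL63.nearZeros χ t η)
    (fun ρ hρ ↦ nearZeros_re_ge hχ hρ)
  -- rewrite Lemma 6.2: `σ = 1`
  simp only [Complex.ofReal_one, sub_self, zero_add] at h62
  rw [← hs] at h62
  -- the near sums combine: `F₀(s − ρ) + f(0)/(s − ρ) = F(s − ρ)` and the odd kernel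
  have hnear : ∀ ρ ∈ KhaleL63.nearZeros χ t η,
      (zeroOrder χ ρ : ℝ) * (fordLaplace₀ f (s - ρ)).re
        - f 0 * ((zeroOrder χ ρ : ℝ) * (fordCot η (ρ - s)).re) =
      (zeroOrder χ ρ : ℝ) * (fordLaplace f (1 + t * I - ρ)
        + (f 0 : ℂ) * (((π / (2 * η) : ℝ) : ℂ) * Complex.cot (((π / (2 * η) : ℝ) : ℂ) * (1 + t * I - ρ))
            - 1 / (1 + t * I - ρ))).re := by
    intro ρ _
    rw [fordCot_sub_rev, ← hs, fordLaplace₀, div_eq_mul_one_div (f 0 : ℂ) (s - ρ)]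
    simp only [sub_re, add_re, neg_re, Complex.mul_re, ofReal_re, ofReal_im, zero_mul, sub_zero]
    ring
  have hsum : (∑ ρ ∈ KhaleL63.nearZeros χ t η, (zeroOrder χ ρ : ℝ) * (fordLaplace₀ f (s - ρ)).re)
      - f 0 * (∑ ρ ∈ KhaleL63.nearZeros χ t η, (zeroOrder χ ρ : ℝ) * (fordCot η (ρ - s)).re) =
      khaleNearSum χ f η t := by
    rw [khaleNearSum, Finset.mul_sum, ← Finset.sum_sub_distrib]
    exact Finset.sum_congr rfl hnear
  -- combine
  have hmul := mul_le_mul_of_nonneg_left h62 hf0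
  rw [mul_sub, mul_add] at hmul
  rw [← hs] at h65
  have key : (khaleK χ f s).re ≤
      -(∑ ρ ∈ KhaleL63.nearZeros χ t η, (zeroOrder χ ρ : ℝ) * (fordLaplace₀ f (s - ρ)).re)
      + f 0 * (∑ ρ ∈ KhaleL63.nearZeros χ t η, (zeroOrder χ ρ : ℝ) * (fordCot η (ρ - s)).re)
      + f 0 * (1 / (2 * η) * (η * Real.log q + 2 / 3 * Real.log (Real.log t)
          + B * η ^ (3 / 2 : ℝ) * Real.log t + Real.log (A + 1)))
      - f 0 * (1 / (4 * η) * ∫ u : ℝ, Real.log ‖χ.LFunction (((1 + η : ℝ) : ℂ) +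
          ((t + u * (2 * η / π) : ℝ) : ℂ) * I)‖ / Real.cosh u ^ 2)
      + D * S + D / (1 + t ^ 2)
      + D * (3.11 + Real.log q / 3 + 1 / 6 * Real.log (1 + t ^ 2)) := by
    have e : -(f 0) * (deriv χ.LFunction s / χ.LFunction s).re =
        f 0 * (-(deriv χ.LFunction s / χ.LFunction s).re) := by ring
    rw [e] at h65
    linarith [hmul, h65]
  have hη0 : η ≠ 0 := hη.ne'
  have e3 : f 0 * (1 / (2 * η) * (η * Real.log q + 2 / 3 * Real.log (Real.log t)
      + B * η ^ (3 / 2 : ℝ) * Real.log t + Real.log (A + 1))) =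
      f 0 / (2 * η) * (2 / 3 * Real.log (Real.log t) + B * η ^ (3 / 2 : ℝ) * Real.log t
        + Real.log (A + 1)) + f 0 / 2 * Real.log q := by
    field_simp
    ring
  have e4 : f 0 * (1 / (4 * η) * ∫ u : ℝ, Real.log ‖χ.LFunction (((1 + η : ℝ) : ℂ) +
      ((t + u * (2 * η / π) : ℝ) : ℂ) * I)‖ / Real.cosh u ^ 2) =
      f 0 / (4 * η) * ∫ u : ℝ, Real.log ‖χ.LFunction (((1 + η : ℝ) : ℂ) +
        ((t + u * (2 * η / π) : ℝ) : ℂ) * I)‖ / Real.cosh u ^ 2 := by ring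
  have e5 : D / (1 + t ^ 2) = D * (1 / (1 + t ^ 2)) := by ring
  rw [← hsum]
  linarith [key, e3, e4, e5]

/-- **Corollary 6.6, primitive case, with the printed error constant.**  Under the hypotheses of
`corollary66`, since `3.11 + (1/6) log(1 + t²) + 1/(1 + t²) ≤ 3.5 + ⅓ log t` for `t ≥ e^{1938}`:
`Re K_χ(1+it) ≤ −khaleNearSum χ f η t + (f(0)/2η)[⅔ log log t + Bη^{3/2} log t + log(A+1)]`
`  + (f(0)/2) log q − (f(0)/4η) ∫ log|L(1 + η + i(t + 2ηu/π), χ)|/cosh²u du`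
`  + D(3.5 + ⅓ log q + ⅓ log t + S)`. [cite: Khale2024, Corollary 6.6] -/
theorem corollary66' {A B : ℝ} (hA : 0 < A) (hB : 0 < B) (hF : HasHurwitzFordBound A B)
    (hprim : χ.IsPrimitive) (hq : 3 ≤ q) {f : ℝ → ℝ} {η η' D : ℝ}
    (hf : IsFordSmoothing f η' D) (hη' : 0 < η') (hη'η : η' ≤ η) (hη2 : η < 1 / 2)
    (hf0 : 0 ≤ f 0) {t : ℝ} (ht : Real.exp 1938 ≤ t) (htq : (q : ℝ) ^ (1 / 100000 : ℝ) ≤ t)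
    (hηt : 1.92 * Real.log (t / 100) ^ (-(2 / 3 : ℝ)) ≤ η) {S : ℝ} (hS : KhaleFarZeroSumLT χ t η S) :
    (khaleK χ f (1 + t * I)).re ≤
      -khaleNearSum χ f η t
      + f 0 / (2 * η) * (2 / 3 * Real.log (Real.log t) + B * η ^ (3 / 2 : ℝ) * Real.log t
          + Real.log (A + 1))
      + f 0 / 2 * Real.log q
      - f 0 / (4 * η) * (∫ u : ℝ, Real.log ‖χ.LFunction (((1 + η : ℝ) : ℂ) +
          ((t + u * (2 * η / π) : ℝ) : ℂ) * I)‖ / Real.cosh u ^ 2)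
      + D * (3.5 + Real.log q / 3 + Real.log t / 3 + S) := by
  have h := corollary66 hA hB hF hprim hq hf hη' hη'η hη2 hf0 ht htq hηt hS
  have hD0 : 0 ≤ D := hf.D_nonneg (by linarith)
  have ht3 : 3 ≤ t := le_trans (by linarith [Real.add_one_le_exp (1938 : ℝ)]) ht
  have ht0 : 0 < t := by linarith
  -- `log(1 + t²) ≤ log 2 + 2 log t` and `1/(1 + t²) ≤ 1/10` for `t ≥ 3`
  have hlog : Real.log (1 + t ^ 2) ≤ Real.log 2 + 2 * Real.log t := by
    rw [← Real.log_rpow ht0, ← Real.log_mul (by norm_num) (by positivity)]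
    refine Real.log_le_log (by positivity) ?_
    rw [show t ^ (2 : ℝ) = t ^ 2 by norm_cast]
    nlinarith
  have hinv : 1 / (1 + t ^ 2) ≤ 1 / 10 :=
    one_div_le_one_div_of_le (by norm_num) (by nlinarith)
  have hl2 := Real.log_two_lt_d9
  have hc : 3.11 + Real.log q / 3 + 1 / 6 * Real.log (1 + t ^ 2) + 1 / (1 + t ^ 2) + S ≤
      3.5 + Real.log q / 3 + Real.log t / 3 + S := by linarith
  linarith [mul_le_mul_of_nonneg_left hc hD0]

end KhaleL66

end Literature.NumberTheory.LFunctions
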